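import Summits.QuantumFields.QCD.Theorems.EulerDescentRetypedContinuumComplementHeavyCalibrationHeavyTransfer
import Summits.QuantumFields.QCD.Theorems.EulerDescentRetypedContinuumComplementHeavyCalibrationTunedFamily
import Literature.MathematicalPhysics.QuantumLattice.SchwartzTensorDensity
import HarnessLib

/-!
# Heavy calibration from a POSITIVE heavy body (the stub, closed conditionally on its seams)
(helper of stub `stub_heavyCalibration`, line `vitali-mass-descent`, crux
`Summit.QuantumFields.QCD.Theses.EulerDescent.RetypedContinuumComplement`, item stmt-QuantumFields-16903)

`stub_heavyCalibration : HeavyCalibration` asks, from the crux's heavy body (above `M_h` every tuple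
carries SOME scheme `(z_b, shift_b)` that is QCD along some OS data `T`, …), for ONE calibrated species
family over `reg` whose own functions converge at heavy tuples and inherit rotations there.  The heavy
body is SIGN-FREE in `z_b`, silent on the fermionic-gauge partition function, and asserts positivity of
no calibrating channel; this file proves the stub's conclusion from the heavy body STRENGTHENED BY
EXACTLY THOSE THREE CLAUSES — `heavyCalibration_of_positiveHeavyBody`: if above `M_h` every tuple `m`
carries a scheme `(z_b, shift_b)` QCD along `T` with (P1) `z_b > 0`, (P2) zero-point function `Z/Z`
eventually `1`, and (P3) for every species `s`, either the truncated two-point Schwinger function of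
`T` on the reference pair is positive, `Re c_T(s) > 0` with
`c_T(s) = 𝔖₂^{ss}(Θf₀ ⊗ f₀) − 𝔖₁^s(Θf₀) 𝔖₁^s(f₀)` (Källén–Lehmann positivity of the channel — the named fact
`KallenLehmannPositivity` for non-trivial `s` and `f₀ ≥ 0`), or the lattice reference connected
function has eventually non-positive real part (the null species `pseudoIm f f`, whose reference
connected functions vanish: `connectedTwoPoint_null`), THEN there is a calibrated family `𝒞` with
prescribed `(τ₀, f₀)` such that `ConvergesOnTensors 𝒞 m ∧ RotationsInheritedAt 𝒞 m` (unfolded) at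
every `m` above `M_h`.  Mechanism: the tuned pinned family (`exists_tunedCalibratedFamily`), ratio
convergence from (P1), (P3) (`tendsto_ratio_of_tendsto_ref` / `_of_eventually_nonpos`, the reference
connected calibrating function converging to `c_T(s)` by the heavy body on the off-diagonal pair,
`tendsto_ref_connectedTwoPoint`), and the heavy transfer
(`convergesOnTensors_and_rotationsInherited_of_ratio_tendsto`).  Def-free theorem file; fully proved.
-/

noncomputable section

namespace Summit.QuantumFields.QCD.Cruxes.RetypedContinuumComplement.VitaliMassDescent

open scoped BigOperators SchwartzMap
open MeasureTheory Filter Topology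
open Literature.MathematicalPhysics.AQFT Literature.Probability.LatticeModels
  Literature.MathematicalPhysics.QuantumLattice Literature.MathematicalPhysics.QuantumFieldTheory

variable {Nf : ℕ}

/-! ### The reference connected calibrating function converges to the truncated 𝔖₂ of `T` -/

/-- The real two-tensor of a pair with DISJOINT topological supports is off-diagonal. [folklore] -/
theorem isOffDiagonal_pair_of_disjoint {g h : 𝓢(EuclideanSpace ℝ (Fin 4), ℝ)}
    (hd : Disjoint (tsupport (g : EuclideanSpace ℝ (Fin 4) → ℝ)) (tsupport (h : EuclideanSpace ℝ (Fin 4) → ℝ)))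
    {F : 𝓢((Fin 2 → EuclideanSpace ℝ (Fin 4)), ℂ)} (hF : IsTensorOf F fun i => ofRealTest (![g, h] i)) :
    IsOffDiagonal F := by
  have key : ∀ x ∈ tsupport (F : (Fin 2 → EuclideanSpace ℝ (Fin 4)) → ℂ), ∀ i : Fin 2,
      x i ∈ tsupport (![g, h] i : EuclideanSpace ℝ (Fin 4) → ℝ) := fun x hx i =>
    tsupport_comp_subset (g := fun t : ℝ => (t : ℂ)) Complex.ofReal_zero _ (hF.tsupport_subset hx i)
  refine IsOffDiagonal.of_tsupport_subset fun x hx hxc => ?_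
  obtain ⟨i, j, hij, hxij⟩ := hxc
  have h0 : x 0 ∈ tsupport (g : EuclideanSpace ℝ (Fin 4) → ℝ) := by simpa using key x hx 0
  have h1 : x 1 ∈ tsupport (h : EuclideanSpace ℝ (Fin 4) → ℝ) := by simpa using key x hx 1
  have h01 : x 0 = x 1 := by
    fin_cases i <;> fin_cases j
    · exact absurd rfl hij
    · exact hxij
    · exact hxij.symm
    · exact absurd rfl hij
  rw [h01] at h0
  exact Set.disjoint_left.1 hd h0 h1

/-- **The reference connected calibrating function converges** along a scheme QCD along `T`, for a
pair `(g, h)` with disjoint supports, to the truncated two-point Schwinger function of `T`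
`𝔖₂(g ⊗ h) − 𝔖₁(g) 𝔖₁(h)` on the canonical witnesses. [folklore] -/
theorem tendsto_ref_connectedTwoPoint {sch : QCDScheme Nf} {T : OSData (QCDField Nf) 4}
    (hT : IsQCDAlong sch T) (s : QCDField Nf) {g h : 𝓢(EuclideanSpace ℝ (Fin 4), ℝ)}
    (hd : Disjoint (tsupport (g : EuclideanSpace ℝ (Fin 4) → ℝ)) (tsupport (h : EuclideanSpace ℝ (Fin 4) → ℝ))) :
    Tendsto (fun k : ℕ => sch.connectedTwoPoint k s s g h) atTop
      (𝓝 (T.schwinger 2 ![s, s] (SchwartzMap.tensorFin 2 fun i => ofRealTest (![g, h] i)) -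
        T.schwinger 1 (fun _ => s) (SchwartzMap.tensorFin 1 fun _ => ofRealTest g) *
          T.schwinger 1 (fun _ => s) (SchwartzMap.tensorFin 1 fun _ => ofRealTest h))) := by
  have h2 : Tendsto (fun k : ℕ => sch.twoPoint k s s g h) atTop
      (𝓝 (T.schwinger 2 ![s, s] (SchwartzMap.tensorFin 2 fun i => ofRealTest (![g, h] i)))) :=
    hT.2.2 2 two_ne_zero ![s, s] ![g, h] _ (isTensorOf_tensorFin _)
      (isOffDiagonal_pair_of_disjoint hd (isTensorOf_tensorFin _))
  exact h2.sub ((tendsto_onePoint_of_isQCDAlong hT s g).mul (tendsto_onePoint_of_isQCDAlong hT s h))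

/-! ### The stub from a positive heavy body -/

/-- **HEAVY CALIBRATION FROM A POSITIVE HEAVY BODY.**  Let `τ₀ > 0` and `f₀ ≠ 0` be a real reference
function in the slab `τ₀/2 ≤ x⁰ ≤ τ₀`.  Suppose that above `M_h` every tuple `m` carries a scheme
`reg.scheme m z_b shift_b` that is QCD along OS data `T` with (P1) `z_b > 0`, (P2) zero-point function
eventually `1`, and (P3) for every species `s`: `Re c_T(s) > 0` for the truncated two-point function of
`T` on `(Θf₀, f₀)`, or eventually `Re ⟨Φ_b^s(Θf₀)Φ_b^s(f₀)⟩_conn ≤ 0`.  Then ONE calibrated species family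
`𝒞` over `reg` with `𝒞.τ₀ = τ₀`, `𝒞.f₀ = f₀` converges on tensors and inherits rotations at every tuple
above `M_h` (the two clauses of `HeavyCalibration`, unfolded). [cite: MontvayMunster1994, §1.7 (1.251)–(1.253) and §5.1] -/
theorem heavyCalibration_of_positiveHeavyBody (reg : QCDRegularisation Nf) {τ₀ : ℝ} (hτ₀ : 0 < τ₀)
    {f₀ : 𝓢(EuclideanSpace ℝ (Fin 4), ℝ)} (hf₀ : f₀ ≠ 0)
    (hsl : tsupport (f₀ : EuclideanSpace ℝ (Fin 4) → ℝ) ⊆ timeSlab 4 (τ₀ / 2) τ₀) (Mh : ℝ)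
    (hHB : ∀ m : Fin Nf → ℝ, (∀ fl, Mh ≤ m fl) →
      ∃ (zb shiftb : QCDField Nf → ℕ → ℝ) (T : OSData (QCDField Nf) 4),
        IsQCDAlong (reg.scheme m zb shiftb) T ∧ (∀ s k, 0 < zb s k) ∧
        (∀ᶠ k in atTop, qcdLatticeSchwinger (reg.scheme m zb shiftb) k 0 ![] ![] = 1) ∧
        ∀ s : QCDField Nf,
          0 < (T.schwinger 2 ![s, s] (SchwartzMap.tensorFin 2 fun i => ofRealTest (![thetaTest 4 f₀, f₀] i)) -
              T.schwinger 1 (fun _ => s) (SchwartzMap.tensorFin 1 fun _ => ofRealTest (thetaTest 4 f₀)) *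
                T.schwinger 1 (fun _ => s) (SchwartzMap.tensorFin 1 fun _ => ofRealTest f₀)).re ∨
          ∀ᶠ k in atTop, ¬ 0 < ((reg.scheme m zb shiftb).connectedTwoPoint k s s (thetaTest 4 f₀) f₀).re) :
    ∃ 𝒞 : CalibratedSpeciesFamily reg, 𝒞.τ₀ = τ₀ ∧ 𝒞.f₀ = f₀ ∧
      ∀ m : Fin Nf → ℝ, (∀ fl, Mh ≤ m fl) →
        (∀ n : ℕ, n ≠ 0 → ∀ (σ : Fin n → QCDField Nf) (f : Fin n → 𝓢(EuclideanSpace ℝ (Fin 4), ℝ))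
          (F : 𝓢((Fin n → EuclideanSpace ℝ (Fin 4)), ℂ)),
          IsTensorOf F (fun i => ofRealTest (f i)) → IsOffDiagonal F →
            ∃ c : ℂ, Tendsto (fun k : ℕ => qcdLatticeSchwinger (𝒞.scheme m) k n σ f) atTop (𝓝 c)) ∧
        (∀ n : ℕ, n ≠ 0 → ∀ (σ : Fin n → QCDField Nf) (f : Fin n → 𝓢(EuclideanSpace ℝ (Fin 4), ℝ))
          (F : 𝓢((Fin n → EuclideanSpace ℝ (Fin 4)), ℂ)),
          IsTensorOf F (fun i => ofRealTest (f i)) → IsOffDiagonal F →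
            ∀ R : EuclideanSpace ℝ (Fin 4) ≃ₗᵢ[ℝ] EuclideanSpace ℝ (Fin 4),
              LinearMap.det (R.toLinearEquiv : EuclideanSpace ℝ (Fin 4) →ₗ[ℝ] EuclideanSpace ℝ (Fin 4)) = 1 →
              ∀ c c' : ℂ, Tendsto (fun k : ℕ => qcdLatticeSchwinger (𝒞.scheme m) k n σ f) atTop (𝓝 c) →
                Tendsto (fun k : ℕ => qcdLatticeSchwinger (𝒞.scheme m) k n σ
                  (fun i => linActTest (𝕜 := ℝ) R (f i))) atTop (𝓝 c') → c' = c) := by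
  classical
  -- the heavy-body data as functions of the tuple (junk `z_b ≡ 1` below the threshold)
  choose zbH shiftbH TH hTH hposH hZH hP3H using hHB
  set zb : (Fin Nf → ℝ) → QCDField Nf → ℕ → ℝ := fun m =>
    if h : ∀ fl, Mh ≤ m fl then zbH m h else fun _ _ => 1 with hzb
  set shiftb : (Fin Nf → ℝ) → QCDField Nf → ℕ → ℝ := fun m =>
    if h : ∀ fl, Mh ≤ m fl then shiftbH m h else fun _ _ => 0 with hshiftb
  have hzbne : ∀ m s k, zb m s k ≠ 0 := fun m s k => by
    simp only [hzb]
    split_ifs with h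
    · exact (hposH m h s k).ne'
    · exact one_ne_zero
  -- the tuned pinned family
  obtain ⟨𝒞, hτ, hf, htune⟩ := exists_tunedCalibratedFamily reg hτ₀ hf₀ hsl zb shiftb hzbne
  refine ⟨𝒞, hτ, hf, fun m hm => ?_⟩
  have hzbm : zb m = zbH m hm := by simp only [hzb, dif_pos hm]
  have hshm : shiftb m = shiftbH m hm := by simp only [hshiftb, dif_pos hm]
  -- the ratios converge, species by species
  have hratio : ∀ s, ∃ Λ : ℝ, Tendsto (fun k : ℕ => 𝒞.z m s k / zbH m hm s k) atTop (𝓝 Λ) := by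
    intro s
    have hdisj : Disjoint (tsupport (thetaTest 4 f₀ : EuclideanSpace ℝ (Fin 4) → ℝ))
        (tsupport (f₀ : EuclideanSpace ℝ (Fin 4) → ℝ)) := by
      rw [← hf]
      exact 𝒞.disjoint_tsupport
    rcases hP3H m hm s with hpos | hnonpos
    · refine ⟨_, tendsto_ratio_of_tendsto_ref 𝒞 m (zbH m hm) s
        (fun k => (reg.scheme m (zbH m hm) (shiftbH m hm)).connectedTwoPoint k s s (thetaTest 4 f₀) f₀)
        (fun k hk => ?_) (fun k => hposH m hm s k) hpos
        (tendsto_ref_connectedTwoPoint (hTH m hm) s hdisj)⟩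
      have h := (htune m s k).1
      rw [hzbm, hshm] at h
      exact h hk
    · refine ⟨1, tendsto_ratio_of_eventually_nonpos 𝒞 m (zbH m hm) s
        (fun k => (reg.scheme m (zbH m hm) (shiftbH m hm)).connectedTwoPoint k s s (thetaTest 4 f₀) f₀)
        (fun k hk => ?_) (fun k => hposH m hm s k) hnonpos⟩
      have h := (htune m s k).2
      rw [hzbm, hshm] at h
      exact h hk
  exact convergesOnTensors_and_rotationsInherited_of_ratio_tendsto 𝒞 m (zbH m hm) (shiftbH m hm) (TH m hm)
    (hTH m hm) (fun s k => (hposH m hm s k).ne') (hZH m hm) hratio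

/-- **Shape record against the registered statement.**  With the crux's hypotheses in context and a
POSITIVE heavy body above `M_h > 0` (clauses (P1)–(P3) of `heavyCalibration_of_positiveHeavyBody` for the
fixed reference function of `exists_calibratedFamily`'s slab), the conclusion of `HeavyCalibration` holds
verbatim: `∃ 𝒞, ∃ M_h' > 0, ∀ m ≥ M_h', ConvergesOnTensors 𝒞 m ∧ RotationsInheritedAt 𝒞 m` (unfolded),
with `M_h' := M_h`. [folklore] -/
theorem heavyCalibration_conclusion_of_positiveHeavyBody (reg : QCDRegularisation Nf) {τ₀ : ℝ}
    (hτ₀ : 0 < τ₀) {f₀ : 𝓢(EuclideanSpace ℝ (Fin 4), ℝ)} (hf₀ : f₀ ≠ 0)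
    (hsl : tsupport (f₀ : EuclideanSpace ℝ (Fin 4) → ℝ) ⊆ timeSlab 4 (τ₀ / 2) τ₀) {Mh : ℝ} (hMh : 0 < Mh)
    (hHB : ∀ m : Fin Nf → ℝ, (∀ fl, Mh ≤ m fl) →
      ∃ (zb shiftb : QCDField Nf → ℕ → ℝ) (T : OSData (QCDField Nf) 4),
        IsQCDAlong (reg.scheme m zb shiftb) T ∧ (∀ s k, 0 < zb s k) ∧
        (∀ᶠ k in atTop, qcdLatticeSchwinger (reg.scheme m zb shiftb) k 0 ![] ![] = 1) ∧
        ∀ s : QCDField Nf,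
          0 < (T.schwinger 2 ![s, s] (SchwartzMap.tensorFin 2 fun i => ofRealTest (![thetaTest 4 f₀, f₀] i)) -
              T.schwinger 1 (fun _ => s) (SchwartzMap.tensorFin 1 fun _ => ofRealTest (thetaTest 4 f₀)) *
                T.schwinger 1 (fun _ => s) (SchwartzMap.tensorFin 1 fun _ => ofRealTest f₀)).re ∨
          ∀ᶠ k in atTop, ¬ 0 < ((reg.scheme m zb shiftb).connectedTwoPoint k s s (thetaTest 4 f₀) f₀).re) :
    ∃ 𝒞 : CalibratedSpeciesFamily reg, ∃ Mh' : ℝ, 0 < Mh' ∧ ∀ m : Fin Nf → ℝ, (∀ fl, Mh' ≤ m fl) →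
      (∀ n : ℕ, n ≠ 0 → ∀ (σ : Fin n → QCDField Nf) (f : Fin n → 𝓢(EuclideanSpace ℝ (Fin 4), ℝ))
        (F : 𝓢((Fin n → EuclideanSpace ℝ (Fin 4)), ℂ)),
        IsTensorOf F (fun i => ofRealTest (f i)) → IsOffDiagonal F →
          ∃ c : ℂ, Tendsto (fun k : ℕ => qcdLatticeSchwinger (𝒞.scheme m) k n σ f) atTop (𝓝 c)) ∧
      (∀ n : ℕ, n ≠ 0 → ∀ (σ : Fin n → QCDField Nf) (f : Fin n → 𝓢(EuclideanSpace ℝ (Fin 4), ℝ))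
        (F : 𝓢((Fin n → EuclideanSpace ℝ (Fin 4)), ℂ)),
        IsTensorOf F (fun i => ofRealTest (f i)) → IsOffDiagonal F →
          ∀ R : EuclideanSpace ℝ (Fin 4) ≃ₗᵢ[ℝ] EuclideanSpace ℝ (Fin 4),
            LinearMap.det (R.toLinearEquiv : EuclideanSpace ℝ (Fin 4) →ₗ[ℝ] EuclideanSpace ℝ (Fin 4)) = 1 →
            ∀ c c' : ℂ, Tendsto (fun k : ℕ => qcdLatticeSchwinger (𝒞.scheme m) k n σ f) atTop (𝓝 c) →
              Tendsto (fun k : ℕ => qcdLatticeSchwinger (𝒞.scheme m) k n σ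
                (fun i => linActTest (𝕜 := ℝ) R (f i))) atTop (𝓝 c') → c' = c) := by
  obtain ⟨𝒞, -, -, h⟩ := heavyCalibration_of_positiveHeavyBody reg hτ₀ hf₀ hsl Mh hHB
  exact ⟨𝒞, Mh, hMh, h⟩

end Summit.QuantumFields.QCD.Cruxes.RetypedContinuumComplement.VitaliMassDescent

end
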